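import Literature.Probability.Percolation.QuadCrossingDuality
import HarnessLib

/-!
# Converse continuum duality in a general quad: no dual path between `∂₀Q` and `∂₂Q` forces an open transversal crossing

Topic `Probability/Percolation`; proofs file towards the named fact `SchrammSmirnov2011_lemma_6_1`
(`QuadCrossingContinuity.lean`; O. Schramm, S. Smirnov, *On the scaling limits of planar
percolation*, Ann. Probab. 39 (2011), arXiv:1101.5820, proof of Lemma 6.1, p. 23: "the proof in
case (3) is symmetric to that of case (2)", and p. 22: "by duality the existence of an open
crossing between `{β}` and `∂₂Q` is equivalent to the absence of a dual closed crossing from `∂₁Q`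
to `∂₃Q`").

`QuadCrossingDuality.lean` proves one direction of continuum planar duality for the drawn lattice
`O ∪ δℤ²` (`O` the union of the open edge segments) in a general topological quad: no open
crossing `∂₀Q → ∂₂Q` gives a dual path `∂₁Q → ∂₃Q` off `O ∪ δℤ²`
(`Quad.exists_path_avoiding_of_not_exists_isCrossing`), and a dual path excludes open crossings.
This file adds the CONVERSE pair needed for case (3) of Lemma 6.1 (where, after relabelling the
sides, the roles of open crossings and dual paths are exchanged):

* `Quad.exists_openCrossing_transversal_of_not_exists_path` — if NO path in `[Q]` joins `∂₀Q` to
  `∂₂Q` off `O ∪ δℤ²`, then some compact connected `K ⊆ [Q] ∩ O` meets `∂₁Q` and `∂₃Q` (an open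
  transversal crossing): by the transposed dual-path lemma
  `Quad.exists_path_avoiding_of_not_crossed'` and `closure_subset_openEdgeUnion_of_isPreconnected`;
* `Quad.not_exists_path_of_openCrossing_transversal` — conversely such a `K` blocks every dual path
  from `∂₀Q` to `∂₂Q` (`Quad.exists_mem_of_isPreconnected_crossing'`).

Everything is proved; no named fact is introduced.

## References

* O. Schramm, S. Smirnov, Ann. Probab. 39 (2011) 1768–1814, arXiv:1101.5820, proof of Lemma 6.1.
  [SchrammSmirnov2011]
* G. Grimmett, *Percolation*, 2nd ed. (1999), §11.2 (planar duality). [GrimmettPercolation1999]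
-/

noncomputable section

open scoped unitInterval
open Set Filter Metric Function
open _root_.Topology
open Literature.Probability.LatticeModels

namespace Literature.Probability.Percolation

namespace QuadCrossing

variable {D : Set ℂ} {δ : ℝ} {ω : BondConfig (Site 2)}

namespace Quad

/-- **No dual path ⇒ an open transversal crossing.**  If no path in `[Q]` joins `∂₀Q` to `∂₂Q`
avoiding the open edges `O = openEdgeUnion δ ω` and the drawn lattice points (`δ > 0`), then some
compact connected `K ⊆ [Q]` inside `O` meets both `∂₁Q` and `∂₃Q`.
[cite: SchrammSmirnov2011, proof of Lemma 6.1, case (3)] -/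
theorem exists_openCrossing_transversal_of_not_exists_path (Q : Quad D) (hδ : 0 < δ)
    (h : ¬ ∃ γ : ℝ → ℂ, ContinuousOn γ (Icc 0 1) ∧ MapsTo γ (Icc 0 1) Q.carrier ∧ γ 0 ∈ Q.side 0 ∧
      γ 1 ∈ Q.side 2 ∧ ∀ t ∈ Icc (0 : ℝ) 1,
        γ t ∉ openEdgeUnion δ ω ∧ γ t ∉ range (meshPoint δ)) :
    ∃ K : Set ℂ, IsCompact K ∧ IsConnected K ∧ K ⊆ Q.carrier ∧ K ⊆ openEdgeUnion δ ω ∧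
      (K ∩ Q.side 1).Nonempty ∧ (K ∩ Q.side 3).Nonempty := by
  set 𝒦 : Set ℂ := (openEdgeUnion δ ω ∪ range (meshPoint δ)) ∩ Q.carrier with h𝒦
  have h𝒦c : IsCompact 𝒦 :=
    Q.isCompact_carrier.inter_left ((isClosed_openEdgeUnion hδ ω).union (isClosed_range_meshPoint hδ))
  by_contra hK
  push Not at hK
  refine h ?_
  obtain ⟨γ, hγc, hγm, hγ0, hγ1, hγ𝒦⟩ := Q.exists_path_avoiding_of_not_crossed' h𝒦c
    inter_subset_right (fun C hC hCc hC1 hC3 => by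
      obtain ⟨a, haC, ha1⟩ := hC1
      obtain ⟨b, hbC, hb3⟩ := hC3
      have hab : a ≠ b := fun heq =>
        Set.disjoint_left.1 (Q.disjoint_side_side_add_two 1) ha1 (heq ▸ hb3)
      have hcl : closure C ⊆ openEdgeUnion δ ω := closure_subset_openEdgeUnion_of_isPreconnected hδ
        hCc (hC.trans inter_subset_left) haC hbC hab
      have hCQ : closure C ⊆ Q.carrier := Q.isCompact_carrier.isClosed.closure_subset_iff.2
        (hC.trans inter_subset_right)
      have h3 := hK (closure C) (h𝒦c.of_isClosed_subset isClosed_closure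
        (h𝒦c.isClosed.closure_subset_iff.2 hC)) ⟨⟨a, subset_closure haC⟩, hCc.closure⟩ hCQ hcl
        ⟨a, subset_closure haC, ha1⟩
      have hb' : b ∈ closure C ∩ Q.side 3 := ⟨subset_closure hbC, hb3⟩
      rw [h3] at hb'
      exact hb')
  refine ⟨γ, hγc, hγm, hγ0, hγ1, fun t ht => ?_⟩
  have hnot : γ t ∉ 𝒦 := hγ𝒦 t ht
  rw [h𝒦] at hnot
  simp only [mem_inter_iff, mem_union, not_and] at hnot
  have := fun h' => hnot h' (hγm ht)
  exact ⟨fun h1 => this (Or.inl h1), fun h2 => this (Or.inr h2)⟩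

/-- **An open transversal crossing excludes dual paths between `∂₀Q` and `∂₂Q`.**  If a preconnected
`K ⊆ [Q] ∩ O` meets `∂₁Q` and `∂₃Q`, every path in `[Q]` from `∂₀Q` to `∂₂Q` meets `O`.
[cite: SchrammSmirnov2011, proof of Lemma 6.1, case (3)] -/
theorem not_exists_path_of_openCrossing_transversal (Q : Quad D) {K : Set ℂ} (hKc : IsCompact K)
    (hKconn : IsPreconnected K) (hKQ : K ⊆ Q.carrier) (hKO : K ⊆ openEdgeUnion δ ω)
    (hK1 : (K ∩ Q.side 1).Nonempty) (hK3 : (K ∩ Q.side 3).Nonempty) :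
    ¬ ∃ γ : ℝ → ℂ, ContinuousOn γ (Icc 0 1) ∧ MapsTo γ (Icc 0 1) Q.carrier ∧ γ 0 ∈ Q.side 0 ∧
      γ 1 ∈ Q.side 2 ∧ ∀ t ∈ Icc (0 : ℝ) 1, γ t ∉ openEdgeUnion δ ω := by
  rintro ⟨γ, hγc, hγm, hγ0, hγ2, hγO⟩
  obtain ⟨t, ht, htK⟩ := Q.exists_mem_of_isPreconnected_crossing' hKc hKconn hKQ hK1 hK3 hγc hγm
    hγ0 hγ2
  exact hγO t ht (hKO htK)

end Quad

end QuadCrossing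

end Literature.Probability.Percolation
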